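import Literature.AlgebraicGeometry.ModuliOfAbelianVarieties.SiegelUniversalFamilyPieceDualStableCover
import Literature.AlgebraicGeometry.HodgeTheory.QuasiProjectiveOfFinite
import Literature.AlgebraicGeometry.Motives.VarietiesGeometricallyIntegralProofs
import HarnessLib

/-!
# The dual of a polarized abelian scheme with quasi-projective total space is quasi-projective (discharge of `hqpÂ`)

Topic `Literature/AlgebraicGeometry/AbelianSchemes`; theorems only (no definition, no named fact, no instance, no notation, no
`sorry`).  Cell hodgecm-mathlib, F-10 (b) tail, (10a)-on-Q (B-p13 (g19)): its binder
`hqpÂ : IsQuasiProjectiveOver (Over.mk (𝓜.univ.D.hat.X.hom ≫ 𝓜.M.hom))` — the total space of the DUAL of the universal abelian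
scheme is quasi-projective over `ℚ` — DISCHARGED from the (F) conjunct «the universal total space is quasi-projective» (B-plan1
(g16) 07:40:03Z cut to B-p15 (g12)).  HC_CM is proved only modulo the 7 printed citations until rung 0 closes; nothing here is
about HC.

ROAD E (every input ★, the chain of ★ `ModuliOfAbelianVarieties/SiegelUniversalFamilyPieceDualStableCover`): a polarization
`λ : A → Â` of type `δ` over a reduced locally noetherian base of characteristic `0`, whose geometric fibres are isogenies, is
flat, surjective, quasi-compact and étale (★ `PolarizationLamEtale`), satisfies the kernel-pair identity (★
`comp_mulN_eq_of_comp_lam_eq`), hence has a QUASI-INVERSE `μ : Â → A`, `λ ≫ μ = [∏ δᵢ]`, which is FINITE (★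
`Polarization.exists_quasiInverse_of_charZero`, [MumfordAV1970] §7 Thm. 4); and a scheme finite over a quasi-projective
`k`-scheme is quasi-projective (★ `HodgeTheory/QuasiProjectiveOfFinite.isQuasiProjectiveOver_of_isFinite`, EGA II 6.1.11).
No quotient `A ∕ ker λ`, no norm of an ample bundle, no transport to `ℂ`.

* `Polarization.isQuasiProjectiveOver_hat_of_isFinite_hom` — any FINITE `S`-morphism `Â → A` transfers quasi-projectivity;
* **`Polarization.isQuasiProjectiveOver_hat`** — generic: `S → Spec K` (`CharZero K`), `S` reduced locally noetherian, `pol` of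
  type `δ` (`∏ δᵢ ≠ 0`) with isogenous geometric fibres, `A` quasi-projective over `K` ⇒ `Â` quasi-projective over `K`;
* **`SiegelFineModuliScheme.isQuasiProjectiveOver_univ_hat`** (`𝓜.M` reduced, e.g. smooth over `ℚ`:
  `…_of_smooth`) — `hqpÂ` verbatim from (F-c″) `IsQuasiProjectiveOver (Over.mk (𝓜.univ.A.X.hom ≫ 𝓜.M.hom))` and `∏ δᵢ ≠ 0`.

## References
* D. Mumford, *Abelian Varieties*, TIFR Studies in Mathematics 5 (1970), §7 Thm. 4 (p. 72) (quasi-inverse of an isogeny). [MumfordAV1970]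
* A. Grothendieck, EGA II (Publ. Math. IHÉS 8, 1961), Cor. 6.1.11 and Prop. 5.3.4 (ii) (finite over quasi-projective). [EGAII]
* D. Mumford, J. Fogarty, F. Kirwan, *Geometric Invariant Theory*, 3rd ed. (1994), Ch. 7 §3 Theorem 7.9 (p. 139) (the universal
  family over `A_{g,d,n}` is quasi-projective). [MumfordFogartyKirwan1994]
-/

noncomputable section

open CategoryTheory CategoryTheory.Limits AlgebraicGeometry MonoidalCategory CartesianMonoidalCategory
open scoped MonObj
open Literature.AlgebraicGeometry.Motives (SchemeOver)
open Literature.AlgebraicGeometry.HodgeTheory (IsQuasiProjectiveOver isQuasiProjectiveOver_of_isFinite)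

namespace Literature.AlgebraicGeometry.AbelianSchemes

namespace AbelianSchemeOver

namespace Polarization

/-! ## §1 Generic: a finite `Â → A` transfers quasi-projectivity; the quasi-inverse of `λ` is such a map -/

section Generic

variable {K : Type} [Field K] {S : SchemeOver K} {A : AbelianSchemeOver S.left} {D : A.DualPair} (pol : A.Polarization D)

omit pol in
/-- **Any FINITE `S`-morphism `Â → A` transfers quasi-projectivity of total spaces** (`Â → A → Spec K` finite over the
quasi-projective `A`; ★ `isQuasiProjectiveOver_of_isFinite`, EGA II 6.1.11). [cite: EGAII, Cor. 6.1.11 and Prop. 5.3.4 (ii)] -/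
theorem isQuasiProjectiveOver_hat_of_isFinite_hom (m : D.hat.X ⟶ A.X) [IsFinite m.left]
    (hA : IsQuasiProjectiveOver (Over.mk (A.X.hom ≫ S.hom) : SchemeOver K)) :
    IsQuasiProjectiveOver (Over.mk (D.hat.X.hom ≫ S.hom) : SchemeOver K) := by
  let h : (Over.mk (D.hat.X.hom ≫ S.hom) : SchemeOver K) ⟶ Over.mk (A.X.hom ≫ S.hom) :=
    Over.homMk m.left (by change m.left ≫ A.X.hom ≫ S.hom = D.hat.X.hom ≫ S.hom; rw [← Category.assoc, Over.w m])
  haveI : IsFinite h.left := ‹IsFinite m.left›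
  exact isQuasiProjectiveOver_of_isFinite h hA

/-- **THE DUAL OF A POLARIZED ABELIAN SCHEME WITH QUASI-PROJECTIVE TOTAL SPACE IS QUASI-PROJECTIVE** (generic form): over a
reduced locally noetherian `S → Spec K`, `CharZero K`, for a polarization `λ` of type `δ` (`∏ δᵢ ≠ 0`) whose geometric fibres are
isogenies, if the total space of `A` is quasi-projective over `K` then so is the total space of `Â = D.hat` — along the FINITE
quasi-inverse `μ : Â → A`, `λ ≫ μ = [∏ δᵢ]` (★ `exists_quasiInverse_of_charZero`, fed by ★ `PolarizationLamEtale` and the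
kernel-pair identity ★ `comp_mulN_eq_of_comp_lam_eq`). [cite: MumfordAV1970, §7 Thm. 4 (p. 72)]
[cite: EGAII, Cor. 6.1.11 and Prop. 5.3.4 (ii)] -/
theorem isQuasiProjectiveOver_hat [CharZero K] [IsReduced S.left] [IsLocallyNoetherian S.left] {g : ℕ} {δ : Fin g → ℕ}
    (hT : pol.HasType δ) (hδ : ∏ i, δ i ≠ 0)
    (hiso : ∀ ⦃Ω : Type⦄ [Field Ω] [IsAlgClosed Ω] (t : Spec (.of Ω) ⟶ S.left),
      haveI := pol.isMonHom
      Motives.AbelianVariety.IsIsogeny (fibreHom pol.lam t))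
    (hA : IsQuasiProjectiveOver (Over.mk (A.X.hom ≫ S.hom) : SchemeOver K)) :
    IsQuasiProjectiveOver (Over.mk (D.hat.X.hom ≫ S.hom) : SchemeOver K) := by
  haveI := pol.isMonHom
  haveI : Flat pol.lam.left := pol.flat_lam_left hiso
  haveI : Surjective pol.lam.left := pol.surjective_lam_left hiso
  haveI : QuasiCompact pol.lam.left := pol.quasiCompact_lam_left
  haveI : Etale pol.lam.left := pol.etale_lam_left_of_charZero S.hom hiso
  obtain ⟨m, -, -, hfin, -⟩ := pol.exists_quasiInverse_of_charZero S.hom hδ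
    (fun g₁ g₂ h => pol.comp_mulN_eq_of_comp_lam_eq hT g₁ g₂ h)
  haveI := hfin
  exact isQuasiProjectiveOver_hat_of_isFinite_hom m hA

end Generic

end Polarization

end AbelianSchemeOver

end Literature.AlgebraicGeometry.AbelianSchemes

/-! ## §2 The universal family of a fine Siegel moduli scheme: `hqpÂ` -/

namespace Literature.AlgebraicGeometry.ModuliOfAbelianVarieties

open Literature.AlgebraicGeometry.AbelianSchemes Literature.AlgebraicGeometry.AbelianSchemes.AbelianSchemeOver

variable {g N : ℕ} {δ : Fin g → ℕ} (𝓜 : SiegelFineModuliScheme g N δ)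

/-- **`hqpÂ` DISCHARGED (reduced form)**: for a fine Siegel moduli scheme `𝓜` over `ℚ` with `𝓜.M` reduced and locally of finite
type and UNIVERSAL TOTAL SPACE QUASI-PROJECTIVE over `ℚ` (the (F) conjunct `IsQuasiProjectiveOver (Over.mk (𝓜.univ.A.X.hom ≫ 𝓜.M.hom))`),
and `∏ δᵢ ≠ 0`, the total space of the DUAL `𝓜.univ.D.hat` of the universal abelian scheme is quasi-projective over `ℚ`
(§1 at the universal triple; its geometric fibres `λ̄_t` are isogenies by ★ `isIsogeny_fibreHom_lam_of_classify`).
[cite: MumfordFogartyKirwan1994, Ch. 7 §3 Theorem 7.9 (p. 139)] [cite: MumfordAV1970, §7 Thm. 4 (p. 72)] -/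
theorem SiegelFineModuliScheme.isQuasiProjectiveOver_univ_hat [LocallyOfFiniteType 𝓜.M.hom] [IsReduced 𝓜.M.left]
    (hX : IsQuasiProjectiveOver (Over.mk (𝓜.univ.A.X.hom ≫ 𝓜.M.hom) : SchemeOver ℚ)) (hδ : ∏ i, δ i ≠ 0) :
    IsQuasiProjectiveOver (Over.mk (𝓜.univ.D.hat.X.hom ≫ 𝓜.M.hom) : SchemeOver ℚ) := by
  haveI : IsLocallyNoetherian 𝓜.M.left := LocallyOfFiniteType.isLocallyNoetherian 𝓜.M.hom
  exact 𝓜.univ.pol.isQuasiProjectiveOver_hat (S := 𝓜.M) 𝓜.univ.hasType hδ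
    (fun Ω _ _ t => 𝓜.isIsogeny_fibreHom_lam_of_classify (T := 𝓜.M) 𝓜.univ t) hX

/-- **`hqpÂ` DISCHARGED (smooth form)**: the same with `𝓜.M` SMOOTH over `ℚ` (the (F) conjunct `Smooth 𝓜.M.hom`; smooth over a
field ⇒ reduced, ★ `Motives.isReduced_of_smooth_over_field`). [cite: MumfordFogartyKirwan1994, Ch. 7 §3 Theorem 7.9 (p. 139)]
[cite: MumfordAV1970, §7 Thm. 4 (p. 72)] -/
theorem SiegelFineModuliScheme.isQuasiProjectiveOver_univ_hat_of_smooth [Smooth 𝓜.M.hom]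
    (hX : IsQuasiProjectiveOver (Over.mk (𝓜.univ.A.X.hom ≫ 𝓜.M.hom) : SchemeOver ℚ)) (hδ : ∏ i, δ i ≠ 0) :
    IsQuasiProjectiveOver (Over.mk (𝓜.univ.D.hat.X.hom ≫ 𝓜.M.hom) : SchemeOver ℚ) := by
  haveI : IsReduced 𝓜.M.left := Literature.AlgebraicGeometry.Motives.isReduced_of_smooth_over_field 𝓜.M.hom
  exact 𝓜.isQuasiProjectiveOver_univ_hat hX hδ

end Literature.AlgebraicGeometry.ModuliOfAbelianVarieties

end
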